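import Literature.RepresentationTheory.HeisenbergGroup.DualLatticePair
import HarnessLib

/-!
# Dual lattice pairs in rank `n` from rank one: `(C₁ⁿ, C₂ⁿ)` for the dot product from `(C₁, C₂)` for multiplication

Topic `RepresentationTheory/HeisenbergGroup`; namespace `Literature.RepresentationTheory.HeisenbergGroup`.  KERNEL ONLY:
theorems; no definition, no named fact, no record, no `sorry`.

`DualLatticePair.lean` / `StoneVonNeumannLatticePair.lean` need ONE dual lattice pair `(B₁, B₂)` for a pairing
`ψ(β x y)` together with unit scalings shrinking to `0`.  For the polarised Heisenberg group of a symplectic space in a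
Darboux basis the pairing is the dot product `x · y` on `Rⁿ × Rⁿ` (`R = F_v`, or `R = 𝐀_fin` the finite adèle ring),
and the natural pair is a BOX: `B₁ = C₁ⁿ`, `B₂ = C₂ⁿ` with `(C₁, C₂)` a dual lattice pair for MULTIPLICATION `ψ(s t)` on
`R × R` — over `F_v`: `(𝒪_v, 𝔠_v)` with `𝔠_v` the conductor lattice of `ψ_v`; over `𝐀_fin`: `(𝒪̂, 𝔠_ψ)`,
`𝔠_ψ = {t ; ψ(𝒪̂ t) = 1}` ([Weil1964, Chap. III n° 37–39]: the `X_v°` and their duals; [MoeglinVignerasWaldspurger1987,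
Chap. 2 I.3]).  This file performs that reduction once and for all, so that the adelic (or local) input to the
Stone–von Neumann files is a statement about the character `ψ` of `R` ALONE:

* §1 **`IsDualLatticePair.pi`**: if `(C₁, C₂)` is a dual lattice pair for `(s, t) ↦ ψ(s t)` then `(C₁ⁿ, C₂ⁿ)`
  (`AddSubgroup.pi`) is a dual lattice pair for `(x, y) ↦ ψ(x · y)` (`Matrix.toLinearMap₂' R 1`): boxes of compact
  open subgroups are compact open, and duality is tested on the coordinate vectors `Pi.single i a`;
* §2 **`exists_units_smul_pi_subset`**: if the unit scalings `a C` shrink to `0` in `R`, the scalings `a Cⁿ` shrink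
  to `0` in `Rⁿ` (one unit for all coordinates, from a box neighbourhood).

Nothing of the cited sources is asserted; everything is proved from Mathlib and the tree.

## References
* [Weil1964] A. Weil, Acta Math. 111 (1964), Chap. I n° 11 (`L × L_*`), Chap. III n° 37–39 (restricted products, `X_v°`).
* [MoeglinVignerasWaldspurger1987] C. Mœglin, M.-F. Vignéras, J.-L. Waldspurger, LNM 1291 (1987), Chap. 2 I.3.
-/

set_option autoImplicit false

noncomputable section

open Matrix Set Filter Topology
open scoped Pointwise

namespace Literature.RepresentationTheory.HeisenbergGroup

variable {R : Type*} [CommRing R] [TopologicalSpace R] (ψ : AddChar R Circle) {ι : Type*} [Fintype ι] [DecidableEq ι]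
  {C₁ C₂ : AddSubgroup R}

/-! ## §1 Boxes of a rank-one dual lattice pair -/

omit [TopologicalSpace R] [Fintype ι] [DecidableEq ι] in
/-- an additive character turns finite sums into products (the copy in `Analysis/Fourier/ContinuousAddCharReal` imports
all of Mathlib; restated here to keep this file light). [cite: MoeglinVignerasWaldspurger1987, Chap. 2 I.3] -/
theorem addChar_map_sum_eq_prod {A M : Type*} [AddCommMonoid A] [CommMonoid M] (φ : AddChar A M) {κ : Type*}
    (s : Finset κ) (f : κ → A) : φ (∑ i ∈ s, f i) = ∏ i ∈ s, φ (f i) := by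
  classical
  induction s using Finset.induction_on with
  | empty => simp
  | insert j s hj ih => rw [Finset.sum_insert hj, Finset.prod_insert hj, AddChar.map_add_eq_mul, ih]

omit [TopologicalSpace R] in
/-- the dot-product pairing `Matrix.toLinearMap₂' R 1` is `x · y`. [cite: MoeglinVignerasWaldspurger1987, Chap. 2 I.3] -/
theorem toLinearMap₂'_one_apply (x y : ι → R) : Matrix.toLinearMap₂' R (1 : Matrix ι ι R) x y = x ⬝ᵥ y := by
  rw [Matrix.toLinearMap₂'_apply', Matrix.one_mulVec]

omit [TopologicalSpace R] [Fintype ι] [DecidableEq ι] in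
/-- a coordinate vector `Pi.single i a`, `a ∈ C`, lies in the box `Cⁿ`. [cite: MoeglinVignerasWaldspurger1987, Chap. 2 I.3] -/
theorem single_mem_pi [DecidableEq ι] (C : AddSubgroup R) (i : ι) {a : R} (ha : a ∈ C) :
    (Pi.single i a : ι → R) ∈ AddSubgroup.pi Set.univ (fun _ : ι => C) := by
  rw [AddSubgroup.mem_pi]
  intro j _
  by_cases hj : j = i
  · subst hj
    rw [Pi.single_eq_same]
    exact ha
  · rw [Pi.single_eq_of_ne hj]
    exact C.zero_mem

/-- **boxes of a rank-one dual lattice pair form a dual lattice pair for the dot product**: if `(C₁, C₂)` is a dual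
lattice pair for `(s, t) ↦ ψ(s t)` on `R × R`, then `(C₁ⁿ, C₂ⁿ)` is one for `(x, y) ↦ ψ(x · y)` on `Rⁿ × Rⁿ` — the
lattice `𝒪ⁿ × 𝔠ⁿ` of the Heisenberg group in a Darboux basis. [cite: MoeglinVignerasWaldspurger1987, Chap. 2 I.3] -/
theorem IsDualLatticePair.pi (h : IsDualLatticePair (LinearMap.mul R R) ψ C₁ C₂) :
    IsDualLatticePair (Matrix.toLinearMap₂' R (1 : Matrix ι ι R)) ψ
      (AddSubgroup.pi Set.univ fun _ : ι => C₁) (AddSubgroup.pi Set.univ fun _ : ι => C₂) where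
  isCompact_left := by
    rw [AddSubgroup.coe_pi]
    exact isCompact_univ_pi fun _ => h.isCompact_left
  isOpen_left := by
    rw [AddSubgroup.coe_pi]
    exact isOpen_set_pi Set.finite_univ fun _ _ => h.isOpen_left
  isCompact_right := by
    rw [AddSubgroup.coe_pi]
    exact isCompact_univ_pi fun _ => h.isCompact_right
  isOpen_right := by
    rw [AddSubgroup.coe_pi]
    exact isOpen_set_pi Set.finite_univ fun _ _ => h.isOpen_right
  mem_right_iff y := by
    rw [AddSubgroup.mem_pi]
    constructor
    · intro hy x hx
      rw [AddSubgroup.mem_pi] at hx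
      rw [toLinearMap₂'_one_apply, dotProduct, addChar_map_sum_eq_prod, Finset.prod_eq_one]
      intro i _
      exact h.apply_eq_one (hx i (Set.mem_univ i)) (hy i (Set.mem_univ i))
    · intro hy i _
      rw [h.mem_right_iff]
      intro a ha
      have h1 := hy _ (single_mem_pi C₁ i ha)
      rw [toLinearMap₂'_one_apply, single_dotProduct] at h1
      exact h1
  mem_left_iff x := by
    rw [AddSubgroup.mem_pi]
    constructor
    · intro hx y hy
      rw [AddSubgroup.mem_pi] at hy
      rw [toLinearMap₂'_one_apply, dotProduct, addChar_map_sum_eq_prod, Finset.prod_eq_one]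
      intro i _
      exact h.apply_eq_one (hx i (Set.mem_univ i)) (hy i (Set.mem_univ i))
    · intro hx i _
      rw [h.mem_left_iff]
      intro b hb
      have h1 := hx _ (single_mem_pi C₂ i hb)
      rw [toLinearMap₂'_one_apply, dotProduct_single] at h1
      exact h1

/-! ## §2 Scalings of boxes -/

omit [DecidableEq ι] in
/-- **scalings of boxes shrink to `0`**: if for every neighbourhood `N₀` of `0` in `R` some unit scaling `a C` lies in
`N₀`, then for every neighbourhood `N` of `0` in `Rⁿ` some `a Cⁿ` lies in `N` (a box neighbourhood inside `N`, the
finite intersection of its sides, one unit for all coordinates). [cite: Weil1964, Chap. III n° 37–39] -/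
theorem exists_units_smul_pi_subset (C : AddSubgroup R)
    (hC : ∀ N₀ ∈ 𝓝 (0 : R), ∃ a : Rˣ, (((a : R) • C : AddSubgroup R) : Set R) ⊆ N₀) (N : Set (ι → R))
    (hN : N ∈ 𝓝 (0 : ι → R)) :
    ∃ a : Rˣ, (((a : R) • AddSubgroup.pi Set.univ (fun _ : ι => C) : AddSubgroup (ι → R)) : Set (ι → R)) ⊆ N := by
  rw [nhds_pi, Filter.mem_pi'] at hN
  obtain ⟨I, t, ht, hts⟩ := hN
  have hU : (⋂ i, t i) ∈ 𝓝 (0 : R) := Filter.iInter_mem.2 ht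
  obtain ⟨a, ha⟩ := hC _ hU
  refine ⟨a, fun x hx => hts ?_⟩
  obtain ⟨s, hs, rfl⟩ := (AddSubgroup.mem_smul_pointwise_iff_exists _ _ _).1 hx
  rw [Set.mem_pi]
  intro i _
  have hsi : s i ∈ C := (AddSubgroup.mem_pi _).1 hs i (Set.mem_univ i)
  have hai : (a : R) • s i ∈ ⋂ i, t i := ha (AddSubgroup.smul_mem_pointwise_smul _ (a : R) _ hsi)
  rw [Pi.smul_apply]
  exact Set.mem_iInter.1 hai i

end Literature.RepresentationTheory.HeisenbergGroup

end
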